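import Summits.AtomisticToContinuum.Crystallization.Theorems.ChartedZeroExcessLayeredLatticeLiouvilleZK
import Summits.AtomisticToContinuum.Crystallization.Theorems.ChartedZeroExcessLayeredLatticeLiouvilleZL

/-!
# Part ZM «Lattice toolkit» (lens-2 g79, NODE 79 — part 1a; sequel of tree `…LatticeLiouvilleZK`, `…ZL`)

Generic lemmas for the PARALLEL case of (L2-C) `CoolShadowLinearChartP` (parts ZN–ZP), I:

* ZM-1 in-sheet lattice vectors `latVec b₁ b₂ q = q.1 • b₁ + q.2 • b₂` and their algebra (the placed cool shadow crystal IS the range of a linear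
  skeleton `linChart u c₁ c₂`: tree ZL `placedCrystal_eq_range_linChart`).
* ZM-2 REAL INDEPENDENCE FROM LENGTHS (`latVec_real_indep`): two vectors of lengths in `[σ₀, β]`, `β < 2σ₀`, with `‖b₁ ± b₂‖ ≥ σ₀`, are
  linearly independent (Gram determinant).
* ZM-3 THE LATTICE LEMMA (`lattice_coords`): if `b₁, b₂` lie in the lattice `ℤc₁ + ℤc₂` and every lattice vector of length `≤ 28/25` is `0` or one
  of the six `latVec b₁ b₂ (loDir k)`, then `ℤc₁ + ℤc₂ = ℤb₁ + ℤb₂` (rounding of rational coordinates; no covering radius needed).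
* ZM-4 THE HEXAGON LEMMA (`hexagon_vectors`): six vectors with the bond pattern of a hexagon, closed under `v ↦ -v` and successive differences,
  ARE the hexagon `latVec (ν 0) (ν 1) ∘ loDir` (dihedral lemma of tree ZD + lengths).

0 sorry; standard axioms.
-/

noncomputable section
open scoped BigOperators Classical InnerProductSpace RealInnerProductSpace
open MeasureTheory Set Metric Filter Topology
open Summit.AtomisticToContinuum.Crystallization.Theorems.ChartedPlanarOrderRigidityDoor (E3 IsClean IsCharted)
open Summit.AtomisticToContinuum.Crystallization.Theorems.ChartedPlanarOrderDensityDichotomy (μS IsSep)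
open Summit.AtomisticToContinuum.Crystallization.Theorems.ChartedPlanarOrderCleanScaleP (IsCleanP IsDoorSetP isCleanP_one_iff isCleanP_μS_iff)
open Summit.AtomisticToContinuum.Crystallization.Theorems.ChartedPlanarOrderMesoCut (LayeredHom EnvClose)
open Summit.AtomisticToContinuum.Crystallization.Theorems.ChartedPlanarOrderDoorLayeredOsc (IsTwoShellAffineGood mem_iff_μS_singleton_ne_zero)
open Literature.MathematicalPhysics.StatisticalMechanics (lennardJones triangularVec₁ triangularVec₂)
open Literature.Geometry.DiscreteGeometry (IsTwoShellGoodSet)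

namespace Summit.AtomisticToContinuum.Crystallization.Theorems.ChartedZeroExcessLayeredLatticeLiouville

/-! ### ZM-1  In-sheet lattice vectors -/

/-- in-sheet lattice vector with integer coordinates `q` in the basis `b₁ b₂`. -/
def latVec (b₁ b₂ : E3) (q : ℤ × ℤ) : E3 := (q.1 : ℝ) • b₁ + (q.2 : ℝ) • b₂

/-- `latVec` is additive. [formal bookkeeping] -/
theorem latVec_add (b₁ b₂ : E3) (q q' : ℤ × ℤ) : latVec b₁ b₂ (q + q') = latVec b₁ b₂ q + latVec b₁ b₂ q' := by
  simp only [latVec, Prod.fst_add, Prod.snd_add, Int.cast_add, add_smul]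
  abel

/-- `latVec` of a negative. [formal bookkeeping] -/
theorem latVec_neg (b₁ b₂ : E3) (q : ℤ × ℤ) : latVec b₁ b₂ (-q) = -latVec b₁ b₂ q := by
  simp only [latVec, Prod.fst_neg, Prod.snd_neg, Int.cast_neg, neg_smul, neg_add]

/-- `latVec` is subtractive. [formal bookkeeping] -/
theorem latVec_sub (b₁ b₂ : E3) (q q' : ℤ × ℤ) : latVec b₁ b₂ (q - q') = latVec b₁ b₂ q - latVec b₁ b₂ q' := by
  rw [sub_eq_add_neg, latVec_add, latVec_neg, ← sub_eq_add_neg]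

/-- `latVec 0 = 0`. [formal bookkeeping] -/
theorem latVec_zero (b₁ b₂ : E3) : latVec b₁ b₂ 0 = 0 := by
  simp [latVec]

/-- `latVec` commutes with integer scaling. [formal bookkeeping] -/
theorem latVec_zsmul (b₁ b₂ : E3) (n : ℤ) (q : ℤ × ℤ) : latVec b₁ b₂ (n • q) = (n : ℝ) • latVec b₁ b₂ q := by
  simp only [latVec, Prod.smul_fst, Prod.smul_snd, smul_eq_mul, Int.cast_mul, mul_smul, smul_add]

/-- a linear chart is its sheet origin plus an in-sheet lattice vector. [formal bookkeeping] -/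
theorem linChart_eq_latVec (o : ℤ → E3) (b₁ b₂ : E3) (k : ℤ) (q : ℤ × ℤ) : linChart o b₁ b₂ (k, q) = o k + latVec b₁ b₂ q := by
  simp only [linChart, latVec]
  abel

/-- lattice vectors of a sub-basis are lattice vectors: `latVec (latVec c A₁) (latVec c A₂) q = latVec c (q.1 • A₁ + q.2 • A₂)`. [formal bookkeeping] -/
theorem latVec_latVec (c₁ c₂ : E3) (A₁ A₂ q : ℤ × ℤ) :
    latVec (latVec c₁ c₂ A₁) (latVec c₁ c₂ A₂) q = latVec c₁ c₂ (q.1 • A₁ + q.2 • A₂) := by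
  rw [latVec_add, latVec_zsmul, latVec_zsmul]
  rfl

/-! ### ZM-2  Real independence from lengths -/

/-- ★ two vectors of lengths in `[σ₀, β]` with `β < 2σ₀` and `‖b₁ - b₂‖, ‖b₁ + b₂‖ ≥ σ₀` are linearly independent over `ℝ` (their Gram
determinant is positive: `|⟪b₁,b₂⟫| ≤ (‖b₁‖² + ‖b₂‖² − σ₀²)/2 < ‖b₁‖‖b₂‖` because `|‖b₁‖ − ‖b₂‖| ≤ β − σ₀ < σ₀`). [this file] -/
theorem latVec_real_indep {b₁ b₂ : E3} {σ₀ β : ℝ} (hσ : 0 < σ₀) (hβ : β < 2 * σ₀) (h₁ : σ₀ ≤ ‖b₁‖) (h₁' : ‖b₁‖ ≤ β)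
    (h₂ : σ₀ ≤ ‖b₂‖)
    (h₂' : ‖b₂‖ ≤ β) (hs : σ₀ ≤ ‖b₁ - b₂‖) (ha : σ₀ ≤ ‖b₁ + b₂‖) {s t : ℝ} (h : s • b₁ + t • b₂ = 0) : s = 0 ∧ t = 0 := by
  set x := ‖b₁‖ with hx
  set y := ‖b₂‖ with hy
  set g := ⟪b₁, b₂⟫_ℝ with hg
  have hsq : ‖b₁ - b₂‖ ^ 2 = x ^ 2 - 2 * g + y ^ 2 := norm_sub_sq_real b₁ b₂
  have haq : ‖b₁ + b₂‖ ^ 2 = x ^ 2 + 2 * g + y ^ 2 := norm_add_sq_real b₁ b₂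
  have hs2 : σ₀ ^ 2 ≤ ‖b₁ - b₂‖ ^ 2 := pow_le_pow_left₀ hσ.le hs 2
  have ha2 : σ₀ ^ 2 ≤ ‖b₁ + b₂‖ ^ 2 := pow_le_pow_left₀ hσ.le ha 2
  have hxy : (x - y) ^ 2 < σ₀ ^ 2 := by nlinarith
  have hp₁ : 0 < x * y - g := by nlinarith
  have hp₂ : 0 < x * y + g := by nlinarith
  have hdet : 0 < x ^ 2 * y ^ 2 - g ^ 2 := by nlinarith [mul_pos hp₁ hp₂]
  have e₁ : s * x ^ 2 + t * g = 0 := by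
    have := congrArg (fun v => ⟪v, b₁⟫_ℝ) h
    simpa [inner_add_left, inner_smul_left, real_inner_self_eq_norm_sq, real_inner_comm, hx, hg] using this
  have e₂ : s * g + t * y ^ 2 = 0 := by
    have := congrArg (fun v => ⟪v, b₂⟫_ℝ) h
    simpa [inner_add_left, inner_smul_left, real_inner_self_eq_norm_sq, hy, hg] using this
  have e₃ : s * (x ^ 2 * y ^ 2 - g ^ 2) = 0 := by linear_combination y ^ 2 * e₁ - g * e₂
  have e₄ : t * (x ^ 2 * y ^ 2 - g ^ 2) = 0 := by linear_combination x ^ 2 * e₂ - g * e₁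
  exact ⟨(mul_eq_zero.1 e₃).resolve_right hdet.ne', (mul_eq_zero.1 e₄).resolve_right hdet.ne'⟩

/-- integer coordinates in an independent pair are unique. [formal bookkeeping] -/
theorem latVec_injective {b₁ b₂ : E3} (hind : ∀ s t : ℝ, s • b₁ + t • b₂ = 0 → s = 0 ∧ t = 0) : Function.Injective (latVec b₁ b₂) := by
  intro q q' h
  have h0 : latVec b₁ b₂ (q - q') = 0 := by rw [latVec_sub, h, sub_self]
  obtain ⟨h1, h2⟩ := hind _ _ h0
  have h1' : (q - q').1 = 0 := by exact_mod_cast h1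
  have h2' : (q - q').2 = 0 := by exact_mod_cast h2
  rw [Prod.fst_sub, sub_eq_zero] at h1'
  rw [Prod.snd_sub, sub_eq_zero] at h2'
  exact Prod.ext h1' h2'

/-! ### ZM-3  The lattice lemma -/

/-- every Löschian direction has a coordinate of absolute value one. [formal bookkeeping] -/
theorem loDir_unit_coord (k : Fin 6) : ((loDir k).1 = 1 ∨ (loDir k).1 = -1) ∨ ((loDir k).2 = 1 ∨ (loDir k).2 = -1) := by
  revert k; decide

/-- ★★ **THE LATTICE LEMMA.**  `b₁, b₂ ∈ ℤc₁ + ℤc₂` of lengths in `[σ₀, β]` (`β < 2σ₀`, `β ≤ 28/25`, `‖b₁ ± b₂‖ ≥ σ₀`); if every vector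
of `ℤc₁ + ℤc₂` of
length `≤ 28/25` is `0` or one of the six `latVec b₁ b₂ (loDir k)`, then EVERY vector of `ℤc₁ + ℤc₂` has integer coordinates in `b₁, b₂`.  (Cramer gives
rational coordinates with denominator the determinant of the inclusion — non-zero by real independence; round them: the remainder has length
`≤ (‖b₁‖ + ‖b₂‖)/2 ≤ 28/25`, so it is `0` or a unit vector, and a unit vector has a coordinate `±1 > 1/2`.) [this file] -/
theorem lattice_coords {c₁ c₂ b₁ b₂ : E3} {σ₀ β : ℝ} (hσ : 0 < σ₀) (hβ : β < 2 * σ₀) (hβ' : β ≤ 28 / 25) (h₁ : σ₀ ≤ ‖b₁‖)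
    (h₁' : ‖b₁‖ ≤ β) (h₂ : σ₀ ≤ ‖b₂‖) (h₂' : ‖b₂‖ ≤ β) (hs : σ₀ ≤ ‖b₁ - b₂‖) (ha : σ₀ ≤ ‖b₁ + b₂‖) (A₁ A₂ : ℤ × ℤ)
    (hb₁ : b₁ = latVec c₁ c₂ A₁)
    (hb₂ : b₂ = latVec c₁ c₂ A₂)
    (hSV : ∀ q : ℤ × ℤ, ‖latVec c₁ c₂ q‖ ≤ 28 / 25 → latVec c₁ c₂ q = 0 ∨ ∃ k : Fin 6, latVec c₁ c₂ q = latVec b₁ b₂ (loDir k))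
    (q₀ : ℤ × ℤ) : ∃ q : ℤ × ℤ, latVec c₁ c₂ q₀ = latVec b₁ b₂ q := by
  have hind := fun s t => latVec_real_indep hσ hβ h₁ h₁' h₂ h₂' hs ha (s := s) (t := t)
  set D : ℤ := A₁.1 * A₂.2 - A₁.2 * A₂.1 with hD
  have hD1 : (D : ℝ) • c₁ = (A₂.2 : ℝ) • b₁ - (A₁.2 : ℝ) • b₂ := by
    rw [hb₁, hb₂]; simp only [latVec, hD, Int.cast_sub, Int.cast_mul, smul_add, smul_smul, sub_smul]
    module
  have hD2 : (D : ℝ) • c₂ = (A₁.1 : ℝ) • b₂ - (A₂.1 : ℝ) • b₁ := by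
    rw [hb₁, hb₂]; simp only [latVec, hD, Int.cast_sub, Int.cast_mul, smul_add, smul_smul, sub_smul]
    module
  have hD0 : (D : ℝ) ≠ 0 := by
    intro h0
    rw [h0, zero_smul] at hD1 hD2
    have e1 := hind (A₂.2 : ℝ) (-(A₁.2 : ℝ)) (by rw [neg_smul, ← sub_eq_add_neg, ← hD1])
    have e2 := hind (-(A₂.1 : ℝ)) (A₁.1 : ℝ) (by rw [neg_smul, add_comm, ← sub_eq_add_neg, ← hD2])
    have hA : A₁ = 0 := Prod.ext (by exact_mod_cast e2.2) (by exact_mod_cast (neg_eq_zero.1 e1.2))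
    have : b₁ = 0 := by rw [hb₁, hA, latVec_zero]
    have : ‖b₁‖ = 0 := by rw [this, norm_zero]
    linarith
  -- rational coordinates of `latVec c₁ c₂ q₀`
  set s : ℝ := ((q₀.1 * A₂.2 - q₀.2 * A₂.1 : ℤ) : ℝ) / D with hsdef
  set t : ℝ := ((q₀.2 * A₁.1 - q₀.1 * A₁.2 : ℤ) : ℝ) / D with htdef
  have hv : latVec c₁ c₂ q₀ = s • b₁ + t • b₂ := by
    have e : (D : ℝ) • latVec c₁ c₂ q₀ =
        ((q₀.1 * A₂.2 - q₀.2 * A₂.1 : ℤ) : ℝ) • b₁ + ((q₀.2 * A₁.1 - q₀.1 * A₁.2 : ℤ) : ℝ) • b₂ := by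
      simp only [latVec, smul_add, smul_comm (D : ℝ) (q₀.1 : ℝ), smul_comm (D : ℝ) (q₀.2 : ℝ), hD1, hD2, Int.cast_sub, Int.cast_mul, smul_sub,
        smul_smul, sub_smul]
      module
    have e' : latVec c₁ c₂ q₀ = (D : ℝ)⁻¹ • ((D : ℝ) • latVec c₁ c₂ q₀) := by rw [smul_smul, inv_mul_cancel₀ hD0, one_smul]
    rw [e', e, smul_add, smul_smul, smul_smul, hsdef, htdef, div_eq_inv_mul, div_eq_inv_mul]
  -- round them
  set i : ℤ := round s with hi
  set j : ℤ := round t with hj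
  have his : |s - i| ≤ 1 / 2 := abs_sub_round s
  have hjt : |t - j| ≤ 1 / 2 := abs_sub_round t
  have hrem : latVec c₁ c₂ (q₀ - (i • A₁ + j • A₂)) = (s - i) • b₁ + (t - j) • b₂ := by
    rw [latVec_sub, hv, ← latVec_latVec c₁ c₂ A₁ A₂ (i, j), ← hb₁, ← hb₂]
    simp only [latVec, sub_smul]
    abel
  have hnorm : ‖latVec c₁ c₂ (q₀ - (i • A₁ + j • A₂))‖ ≤ 28 / 25 := by
    rw [hrem]
    calc ‖(s - ↑i) • b₁ + (t - ↑j) • b₂‖ ≤ ‖(s - ↑i) • b₁‖ + ‖(t - ↑j) • b₂‖ := norm_add_le _ _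
      _ = |s - i| * ‖b₁‖ + |t - j| * ‖b₂‖ := by rw [norm_smul, norm_smul, Real.norm_eq_abs, Real.norm_eq_abs]
      _ ≤ 1 / 2 * β + 1 / 2 * β := by gcongr
      _ ≤ 28 / 25 := by linarith
  rcases hSV _ hnorm with h0 | ⟨k, hk⟩
  · refine ⟨(i, j), ?_⟩
    have : latVec c₁ c₂ q₀ - latVec b₁ b₂ (i, j) = 0 := by
      rw [← h0, latVec_sub, ← latVec_latVec c₁ c₂ A₁ A₂ (i, j), ← hb₁, ← hb₂]
    exact sub_eq_zero.1 this
  · exfalso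
    rw [hrem] at hk
    have e : (s - i - (loDir k).1) • b₁ + (t - j - (loDir k).2) • b₂ = 0 := by
      rw [sub_smul (s - i), sub_smul (t - j)]
      have : latVec b₁ b₂ (loDir k) = ((loDir k).1 : ℝ) • b₁ + ((loDir k).2 : ℝ) • b₂ := rfl
      rw [this] at hk
      rw [← sub_eq_zero] at hk
      rw [← hk]
      abel
    obtain ⟨e1, e2⟩ := hind _ _ e
    have his' := abs_le.1 his
    have hjt' := abs_le.1 hjt
    rcases loDir_unit_coord k with (h | h) | (h | h)
    · have : ((loDir k).1 : ℝ) = 1 := by exact_mod_cast h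
      linarith
    · have : ((loDir k).1 : ℝ) = -1 := by exact_mod_cast h
      linarith
    · have : ((loDir k).2 : ℝ) = 1 := by exact_mod_cast h
      linarith
    · have : ((loDir k).2 : ℝ) = -1 := by exact_mod_cast h
      linarith

/-! ### ZM-4  The hexagon lemma -/

/-- the dihedral elements compatible with an antipodal-type involution: a fixed-point-free involutive ROTATION is the antipodal map; a fixed-point-free
REFLECTION moves some index to an adjacent one. [formal bookkeeping, `decide`] -/
theorem dihedral_antipodal_aux : ∀ a : Fin 6,
    ((∀ k : Fin 6, a + (a + k) = k) → (∀ k : Fin 6, a + k ≠ k) → ∀ k : Fin 6, a + k = k + 3) ∧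
      ((∀ k : Fin 6, a - k ≠ k) → (∀ k : Fin 6, ¬ CycAdj k (a - k)) → False) := by
  decide

/-- small facts on `Fin 6`. [formal bookkeeping, `decide`] -/
theorem fin6_aux (i : Fin 6) : i ≠ i + 1 ∧ i ≠ i + 3 ∧ ¬ CycAdj (i + 3) i ∧ i - 1 + 1 = i ∧ (i + 1) - 1 = i ∧ i + 1 + 1 = i + 2 := by
  revert i; decide

/-- ★★ **THE HEXAGON LEMMA.**  Six pairwise distinct vectors `ν i` of lengths in `[σ₀, β]` (`β < 2σ₀`) with the BOND PATTERN OF A HEXAGON — successive ones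
within `β`, non-adjacent distinct ones farther than `β` — such that each `-ν i` and each difference `ν (i+1) - ν i` is again one of the six: then
`ν (i+3) = -ν i` and `ν (i+2) = ν (i+1) - ν i` (so `ν = latVec (ν 0) (ν 1) ∘ loDir`, `hexagon_latVec`).  (The map `ν i ↦ -ν i` is an injective
adjacency-preserving self-map of the six-cycle, hence dihedral (tree ZD); it is a fixed-point-free involution never moving an index to an adjacent
one — `‖ν i - (-ν i)‖ = 2‖ν i‖ > β` — so it is the antipodal rotation; the difference relation then follows from the two bond constraints
on it.) [this file] -/
theorem hexagon_vectors {ν : Fin 6 → E3} {σ₀ β : ℝ} (hσ : 0 < σ₀) (hβ : β < 2 * σ₀) (hlo : ∀ i, σ₀ ≤ ‖ν i‖) (hhi : ∀ i, ‖ν i‖ ≤ β)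
    (hadj : ∀ i, ‖ν i - ν (i + 1)‖ ≤ β) (hfar : ∀ i j, i ≠ j → ¬ CycAdj i j → β < ‖ν i - ν j‖) (hinj : Function.Injective ν)
    (hneg : ∀ i, ∃ j, ν j = -ν i) (hdif : ∀ i, ∃ j, ν j = ν (i + 1) - ν i) :
    ∀ i, ν (i + 3) = -ν i ∧ ν (i + 2) = ν (i + 1) - ν i := by
  -- bonds read combinatorially
  have near : ∀ i j, ‖ν i - ν j‖ ≤ β → i = j ∨ CycAdj i j := by
    intro i j h
    by_contra hc
    rw [not_or] at hc
    exact absurd h (not_le.2 (hfar i j hc.1 hc.2))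
  have hadj' : ∀ i j, CycAdj i j → ‖ν i - ν j‖ ≤ β := by
    rintro i j (rfl | rfl)
    · exact hadj i
    · rw [norm_sub_rev]
      have := hadj (i - 1)
      rwa [(fin6_aux i).2.2.2.1] at this
  -- the antipodal map
  choose g hg using hneg
  have ginj : Function.Injective g := fun i j h => hinj (neg_injective (by rw [← hg i, ← hg j, h]))
  have gg : ∀ k, g (g k) = k := fun k => hinj (by rw [hg, hg, neg_neg])
  have gfix : ∀ k, g k ≠ k := by
    intro k h
    have e : ‖ν k - ν (g k)‖ = 2 * ‖ν k‖ := by rw [hg, sub_neg_eq_add, ← two_smul ℝ, norm_smul, Real.norm_two]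
    rw [h, sub_self, norm_zero] at e
    linarith [hlo k]
  have gadj : ∀ k, ¬ CycAdj k (g k) := by
    intro k h
    have h1 := hadj' k (g k) h
    rw [hg, sub_neg_eq_add, ← two_smul ℝ, norm_smul, Real.norm_two] at h1
    linarith [hlo k]
  have gcyc : ∀ k, CycAdj (g k) (g (k + 1)) := by
    intro k
    have h1 : ‖ν (g k) - ν (g (k + 1))‖ ≤ β := by
      rw [hg, hg, ← neg_sub', norm_neg, norm_sub_rev]
      simpa [norm_sub_rev] using hadj k
    rcases near _ _ h1 with h | h
    · exact absurd (ginj h) (fin6_aux k).1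
    · exact h
  have anti : ∀ k, ν (k + 3) = -ν k := by
    intro k
    rcases dihedral_of_cycHom g ginj gcyc with hrot | hrefl
    · have h3 := (dihedral_antipodal_aux (g 0)).1 (fun k => by rw [← hrot, ← hrot, gg]) (fun k => by rw [← hrot]; exact gfix k) k
      rw [← hg k, hrot k, h3]
    · exact ((dihedral_antipodal_aux (g 0)).2 (fun k => by rw [← hrefl]; exact gfix k) (fun k => by rw [← hrefl]; exact gadj k)).elim
  refine fun i => ⟨anti i, ?_⟩
  obtain ⟨j, hj⟩ := hdif i
  have c1 : j = i + 2 ∨ j = i := by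
    have h1 : ‖ν (i + 1) - ν j‖ ≤ β := by
      rw [hj, sub_sub_cancel]; exact hhi i
    rcases near _ _ h1 with h | (h | h)
    · exfalso
      have : ν i = 0 := by
        have := hj
        rw [← h] at this
        exact (sub_eq_self.1 this.symm)
      have h' := hlo i
      rw [this, norm_zero] at h'
      linarith
    · left; rw [h, (fin6_aux i).2.2.2.2.2]
    · right; rw [h, (fin6_aux i).2.2.2.2.1]
  have c2 : i + 3 = j ∨ CycAdj (i + 3) j := by
    apply near
    have e : -ν i - (ν (i + 1) - ν i) = -ν (i + 1) := by abel
    rw [anti i, hj, e, norm_neg]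
    exact hhi (i + 1)
  rcases c1 with h | h
  · rw [← h, hj]
  · exfalso
    rw [h] at c2
    rcases c2 with h' | h'
    · exact (fin6_aux i).2.1 h'.symm
    · exact (fin6_aux i).2.2.1 h'

/-- the hexagon relations make `ν` the Löschian hexagon on `ν 0, ν 1`. [formal bookkeeping] -/
theorem hexagon_latVec {ν : Fin 6 → E3} (h : ∀ i, ν (i + 3) = -ν i ∧ ν (i + 2) = ν (i + 1) - ν i) (k : Fin 6) :
    ν k = latVec (ν 0) (ν 1) (loDir k) := by
  have h2 : ν 2 = ν 1 - ν 0 := by simpa using (h 0).2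
  have h3 : ν 3 = -ν 0 := by simpa using (h 0).1
  have h4 : ν 4 = -ν 1 := by simpa using (h 1).1
  have h5 : ν 5 = -ν 2 := by simpa using (h 2).1
  fin_cases k <;> simp [latVec, loDir, h2, h3, h4, h5] <;> abel

end Summit.AtomisticToContinuum.Crystallization.Theorems.ChartedZeroExcessLayeredLatticeLiouville
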